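import Summits.CriticalPhenomena.PercolationContinuityZ3.Theorems.PercNearOneGluingNoHeavyQuantSingleGateDominant
import HarnessLib

/-!
# QUANT lane R8, T-DEC: CONVOLUTION CLOSURE AT EVERY DOMINANT LAYER — part 1 (the two one-factor lemmas and the assembly)

builds on p205010 (kernel theorem, internal audit signed; external expert review pending)

Support file (`--supports stmt-CriticalPhenomena-4575`), QUANT lane seat prim-quant-arm-2 (gen 34), rung R8 of
`run/shared/lean/prim/quant/LADDER.md`.  Theorems only (no definitions), standard axioms, no sorries.  Part 1 of 2: part 2
`…QuantDominantClosure` has the theorem **`gateConv_tail_ge_dominant`**: if the gated factors `gate_q μ₁`, `gate_q μ₂` satisfy the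
'deep lows ride on the giants' inequalities `y·ν{≤ i′} ≤ (1−y)·ν{> i}` (`i′ ≤ i`, `i + i′ < tᵢ`; `deepLows_le_giants` — in particular for
top-affordable laws DEC at every layer, `tᵢ = q·Tᵢ`), then `y ≤ Σ_{h > j} gate_q(μ₁ ∗ μ₂) h` at EVERY layer `2j < t₁ + t₂` — no heaviness, no
far regime; it supersedes the dominant-layer theorems of `…QuantConvDominant`, `…QuantSingleGateDominant`, `…QuantConvFarDominant`,
`…QuantGateMoveBlobDominant` (which remain as stated).

THE ARGUMENT (extreme profiles).  Write `φ(i) = ν₁{> i}`.  The inequalities for `ν₁` say `(1−y)φ(i) + yφ(i′) ≥ y` (`i′ ≤ i`, `i + i′ < t₁`);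
the minimal profiles are determined by their values on the dominant layers `2i < t₁`, affinely, and the extreme ones are the profiles of
the two-point laws `(1−y)·δ_k + y·δ_{⌈t₁−k⌉}` (`2k < t₁`) and of `δ_{⌈t₁/2⌉}`.  Concretely (`profile_minorant`): for every `i`,
`(1−y)·φ(i) ≥ Σ_{2k < t₁} ν₁(k)·([i < k] + y·[k ≤ i, i + k < t₁]) + (ν₁{2k ≥ t₁} − y)·[2i < t₁]` (an identity at dominant `i`, one
inequality of the family at the others).  Against each extreme profile the tail of the product above `j` is
`q·μ₂{> j} + μ₂(j−k, j] + y·μ₂(j+k−t₁, j−k]` (`piece_ge`), and ONE inequality of the family for `ν₂` at `(a, a′) = (j−k, ⌊j+k−t₁⌋)`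
(`a + a′ ≤ 2j − t₁ < t₂`) makes it `≥ y` once `q·μ₂{> j} ≤ y` (else the tail is `≥ q·μ₂{> j} ≥ y` outright).  `assemble` is the bookkeeping.

* `LawDec.piece_ge` — the factor-2 estimate against one extreme profile (real shift `κ ≥ 0`).
* `LawDec.profile_minorant` — the factor-1 minorant.
* `LawDec.nondominant_mass_ge` — `ν{2k ≥ t} ≥ y` (the far row at the last dominant layer).
* `LawDec.assemble_dominant` — the linear bookkeeping `Σ_s μ₂(s)·(1−y)V(s) ≥ Σ_k c_k·T_k + R·T′ ≥ (1−y)·y`.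

[this work]; DEC rules ARCH-TREES-G49 §2.2 / DEC-TAMP-G50 §3.1 (this lane).  Nothing here is cited as a published result; the extreme points
of monotone boxes / first-order stochastic dominance are classical.  The gluing rows served [cite: KozmaNitzan2024, Conjecture 3 (p. 15)];
product measure [cite: Grimmett1999, §1.3 p. 10].
-/

noncomputable section

namespace Summit.CriticalPhenomena.PercolationContinuityZ3.Theorems

namespace Quant

open Finset

/-- the mass of `μ` (a law on `{0..M}`) strictly above the layer `a` -/
local notation3 "TAIL[" μ ", " M ", " a "]" =>
  ∑ h ∈ Finset.range ((M : ℕ) + 1), (if (a : ℕ) + 1 ≤ h then (μ : ℕ → ℝ) h else 0)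

/-- the mass of `μ` (a law on `{0..M}`) at or below the layer `a` -/
local notation3 "LOW[" μ ", " M ", " a "]" =>
  ∑ h ∈ Finset.range ((M : ℕ) + 1), (if h ≤ (a : ℕ) then (μ : ℕ → ℝ) h else 0)

namespace LawDec

/-! ### Factor 2: the tail against one extreme profile -/

/-- **the tail of the product against one extreme profile is `≥ y`.**  `μ₂` a probability law on `{0..M₂}` whose gated law satisfies the
two-layer giant bounds at target `t₂` (in the form `y·(1 − q·μ₂{> i′}) ≤ (1−y)·q·μ₂{> a}`, `i′ ≤ a`, `a + i′ < t₂`), `0 < y ≤ q ≤ 1`, `κ ≥ 0`,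
`2j < t₁ + t₂`, and `q·μ₂{> j} ≤ y`.  Then
`y ≤ Σ_s μ₂(s)·( [s > j]·q + [s ≤ j]·([j < s + κ] + y·[s + κ ≤ j, j + κ < t₁ + s]) )`. [this work] -/
theorem piece_ge (y q t₁ t₂ κ : ℝ) (j M₂ : ℕ) (μ₂ : ℕ → ℝ) (hy0 : 0 < y) (hyq : y ≤ q) (hq1 : q ≤ 1)
    (h20 : ∀ h, 0 ≤ μ₂ h) (h21 : ∑ h ∈ Finset.range (M₂ + 1), μ₂ h = 1)
    (hdl2 : ∀ a i' : ℕ, i' ≤ a → (a : ℝ) + i' < t₂ → y * (1 - q * TAIL[μ₂, M₂, i']) ≤ (1 - y) * (q * TAIL[μ₂, M₂, a]))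
    (hκ : 0 ≤ κ) (hdom : 2 * (j : ℝ) < t₁ + t₂) (hcase : q * TAIL[μ₂, M₂, j] ≤ y) :
    y ≤ ∑ s ∈ Finset.range (M₂ + 1), μ₂ s * (if j + 1 ≤ s then q else
      ((if (j : ℝ) < s + κ then (1 : ℝ) else 0) + y * (if (s : ℝ) + κ ≤ j ∧ (j : ℝ) + κ < t₁ + s then (1 : ℝ) else 0))) := by
  have hq0 : 0 < q := hy0.trans_le hyq
  have hG0 : ∀ a : ℕ, 0 ≤ TAIL[μ₂, M₂, a] := fun a => Finset.sum_nonneg fun h _ => by split_ifs; exacts [h20 h, le_rfl]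
  have hGL : ∀ a : ℕ, LOW[μ₂, M₂, a] + TAIL[μ₂, M₂, a] = 1 := fun a => by rw [sum_le_add_sum_gt, h21]
  have hL0 : ∀ a : ℕ, 0 ≤ LOW[μ₂, M₂, a] := fun a => Finset.sum_nonneg fun h _ => by split_ifs; exacts [h20 h, le_rfl]
  have hGanti : ∀ a b : ℕ, a ≤ b → TAIL[μ₂, M₂, b] ≤ TAIL[μ₂, M₂, a] := fun a b hab => sum_gt_antitone M₂ b a μ₂ h20 hab
  -- split the sum into its three indicator sums
  have hsplit : ∑ s ∈ Finset.range (M₂ + 1), μ₂ s * (if j + 1 ≤ s then q else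
      ((if (j : ℝ) < s + κ then (1 : ℝ) else 0) + y * (if (s : ℝ) + κ ≤ j ∧ (j : ℝ) + κ < t₁ + s then (1 : ℝ) else 0)))
      = q * TAIL[μ₂, M₂, j] + ∑ s ∈ Finset.range (M₂ + 1), (if s ≤ j ∧ (j : ℝ) < s + κ then μ₂ s else 0)
        + y * ∑ s ∈ Finset.range (M₂ + 1), (if (s : ℝ) + κ ≤ j ∧ (j : ℝ) + κ < t₁ + s then μ₂ s else 0) := by
    rw [Finset.mul_sum, Finset.mul_sum, ← Finset.sum_add_distrib, ← Finset.sum_add_distrib]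
    refine Finset.sum_congr rfl fun s _ => ?_
    by_cases hs : j + 1 ≤ s
    · have hs' : (j : ℝ) + 1 ≤ s := by exact_mod_cast hs
      rw [if_pos hs, if_pos hs, if_neg (show ¬ (s ≤ j ∧ (j : ℝ) < s + κ) by omega),
        if_neg (show ¬ ((s : ℝ) + κ ≤ j ∧ (j : ℝ) + κ < t₁ + s) from fun h => by rcases h with ⟨h1, _⟩; linarith)]; ring
    · rw [if_neg hs, if_neg hs]
      by_cases h1 : (j : ℝ) < s + κ
      · rw [if_pos h1, if_pos (show s ≤ j ∧ (j : ℝ) < s + κ from ⟨by omega, h1⟩)]; split_ifs <;> ring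
      · rw [if_neg h1, if_neg (show ¬ (s ≤ j ∧ (j : ℝ) < s + κ) from fun h => h1 h.2)]; split_ifs <;> ring
  rw [hsplit]
  by_cases hκj : (j : ℝ) < κ
  · -- every `s ≤ j` has `j < s + κ`: the middle sum is all of `μ₂{≤ j}`
    have hmid : ∑ s ∈ Finset.range (M₂ + 1), (if s ≤ j ∧ (j : ℝ) < s + κ then μ₂ s else 0) = LOW[μ₂, M₂, j] :=
      Finset.sum_congr rfl fun s _ => by
        by_cases hs : s ≤ j
        · rw [if_pos ⟨hs, by linarith [(Nat.cast_nonneg s : (0 : ℝ) ≤ s)]⟩, if_pos hs]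
        · rw [if_neg (fun h => hs h.1), if_neg hs]
    have h3 : 0 ≤ ∑ s ∈ Finset.range (M₂ + 1), (if (s : ℝ) + κ ≤ j ∧ (j : ℝ) + κ < t₁ + s then μ₂ s else 0) :=
      Finset.sum_nonneg fun s _ => by split_ifs; exacts [h20 s, le_rfl]
    rw [hmid]
    have := hGL j
    nlinarith [hG0 j, mul_nonneg hy0.le h3]
  · have hκj' : κ ≤ (j : ℝ) := not_lt.1 hκj
    have hx0 : 0 ≤ (j : ℝ) - κ := by linarith
    set a : ℕ := ⌊(j : ℝ) - κ⌋₊ with ha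
    have ha1 : (a : ℝ) ≤ j - κ := Nat.floor_le hx0
    have ha2 : (j : ℝ) - κ < a + 1 := Nat.lt_floor_add_one _
    have haj : a ≤ j := by
      have : (a : ℝ) ≤ j := by linarith
      exact_mod_cast this
    -- the middle sum is `μ₂(a, j]`
    have hmid : ∑ s ∈ Finset.range (M₂ + 1), (if s ≤ j ∧ (j : ℝ) < s + κ then μ₂ s else 0) + TAIL[μ₂, M₂, j] = TAIL[μ₂, M₂, a] := by
      rw [← Finset.sum_add_distrib]
      refine Finset.sum_congr rfl fun s _ => ?_
      have e : ((j : ℝ) < s + κ) ↔ a + 1 ≤ s := by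
        rw [show ((j : ℝ) < s + κ) ↔ ((j : ℝ) - κ < s) from ⟨fun h => by linarith, fun h => by linarith⟩, ← Nat.floor_lt hx0]
        exact Nat.lt_iff_add_one_le  -- `a < s ↔ a + 1 ≤ s`
      by_cases hs1 : a + 1 ≤ s
      · by_cases hs2 : s ≤ j
        · rw [if_pos ⟨hs2, e.2 hs1⟩, if_neg (by omega), if_pos hs1, add_zero]
        · rw [if_neg (fun h => hs2 h.1), if_pos (by omega), if_pos hs1, zero_add]
      · rw [if_neg (fun h => hs1 (e.1 h.2)), if_neg (by omega), if_neg hs1, add_zero]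
    -- the deep sum
    set u : ℝ := (j : ℝ) + κ - t₁ with hu
    have econd : ∀ s : ℕ, ((s : ℝ) + κ ≤ j ∧ (j : ℝ) + κ < t₁ + s) ↔ (s ≤ a ∧ u < s) := by
      intro s
      rw [Nat.le_floor_iff hx0]
      exact ⟨fun ⟨h1, h2⟩ => ⟨by linarith, by rw [hu]; linarith⟩, fun ⟨h1, h2⟩ => ⟨by linarith, by rw [hu] at h2; linarith⟩⟩
    have hdeep : ∑ s ∈ Finset.range (M₂ + 1), (if (s : ℝ) + κ ≤ j ∧ (j : ℝ) + κ < t₁ + s then μ₂ s else 0)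
        = ∑ s ∈ Finset.range (M₂ + 1), (if s ≤ a ∧ u < s then μ₂ s else 0) :=
      Finset.sum_congr rfl fun s _ => by simp only [econd s]
    rw [hdeep]
    by_cases hu0 : u < 0
    · -- every `s ≤ a` is deep
      have hd : ∑ s ∈ Finset.range (M₂ + 1), (if s ≤ a ∧ u < s then μ₂ s else 0) = LOW[μ₂, M₂, a] :=
        Finset.sum_congr rfl fun s _ => by
          by_cases hs : s ≤ a
          · rw [if_pos ⟨hs, by linarith [(Nat.cast_nonneg s : (0 : ℝ) ≤ s)]⟩, if_pos hs]
          · rw [if_neg (fun h => hs h.1), if_neg hs]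
      rw [hd]
      have e1 := hGL a
      have e2 := hGanti a j haj
      have e3 : (1 - y) * TAIL[μ₂, M₂, j] ≤ (1 - y) * TAIL[μ₂, M₂, a] := mul_le_mul_of_nonneg_left e2 (by linarith)
      have e4 : 0 ≤ (q - y) * TAIL[μ₂, M₂, j] := mul_nonneg (by linarith) (hG0 j)
      nlinarith
    · have hu0' : 0 ≤ u := not_lt.1 hu0
      set i' : ℕ := ⌊u⌋₊ with hi'
      have hi'1 : (i' : ℝ) ≤ u := Nat.floor_le hu0'
      have econd' : ∀ s : ℕ, (u < s) ↔ i' + 1 ≤ s := fun s => by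
        rw [← Nat.floor_lt hu0']; exact Nat.lt_iff_add_one_le
      by_cases hia : i' ≤ a
      · -- the deep sum is `μ₂(i', a]`; one two-layer bound at `(a, i')`
        have hd : ∑ s ∈ Finset.range (M₂ + 1), (if s ≤ a ∧ u < s then μ₂ s else 0) + TAIL[μ₂, M₂, a] = TAIL[μ₂, M₂, i'] := by
          rw [← Finset.sum_add_distrib]
          refine Finset.sum_congr rfl fun s _ => ?_
          by_cases hs1 : i' + 1 ≤ s
          · by_cases hs2 : s ≤ a
            · rw [if_pos ⟨hs2, (econd' s).2 hs1⟩, if_neg (by omega), if_pos hs1, add_zero]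
            · rw [if_neg (fun h => hs2 h.1), if_pos (by omega), if_pos hs1, zero_add]
          · rw [if_neg (fun h => hs1 ((econd' s).1 h.2)), if_neg (by omega), if_neg hs1, add_zero]
        have key := hdl2 a i' hia (by linarith)
        have e3 : (1 - q) * (q * TAIL[μ₂, M₂, j]) ≤ (1 - q) * y := mul_le_mul_of_nonneg_left hcase (by linarith)
        -- `q·(total) ≥ q·y`
        have htot : q * y ≤ q * (q * TAIL[μ₂, M₂, j] + ∑ s ∈ Finset.range (M₂ + 1), (if s ≤ j ∧ (j : ℝ) < s + κ then μ₂ s else 0)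
            + y * ∑ s ∈ Finset.range (M₂ + 1), (if s ≤ a ∧ u < s then μ₂ s else 0)) := by
          have e5 : q * (q * TAIL[μ₂, M₂, j] + ∑ s ∈ Finset.range (M₂ + 1), (if s ≤ j ∧ (j : ℝ) < s + κ then μ₂ s else 0)
              + y * ∑ s ∈ Finset.range (M₂ + 1), (if s ≤ a ∧ u < s then μ₂ s else 0))
              = (1 - y) * (q * TAIL[μ₂, M₂, a]) + y * (q * TAIL[μ₂, M₂, i']) - (1 - q) * (q * TAIL[μ₂, M₂, j]) := by
            rw [show ∑ s ∈ Finset.range (M₂ + 1), (if s ≤ j ∧ (j : ℝ) < s + κ then μ₂ s else 0)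
                = TAIL[μ₂, M₂, a] - TAIL[μ₂, M₂, j] by rw [← hmid]; ring,
              show ∑ s ∈ Finset.range (M₂ + 1), (if s ≤ a ∧ u < s then μ₂ s else 0)
                = TAIL[μ₂, M₂, i'] - TAIL[μ₂, M₂, a] by rw [← hd]; ring]
            ring
          rw [e5]
          nlinarith
        exact le_of_mul_le_mul_left htot hq0
      · -- no deep atom: the far row of `gate_q μ₂` at the dominant layer `a`
        have hia' : a < i' := not_le.1 hia
        have hd : ∑ s ∈ Finset.range (M₂ + 1), (if s ≤ a ∧ u < s then μ₂ s else 0) = 0 :=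
          Finset.sum_eq_zero fun s _ => if_neg fun h => by have := (econd' s).1 h.2; omega
        have hau : (a : ℝ) + 1 ≤ u := by
          have : ((a + 1 : ℕ) : ℝ) ≤ i' := by exact_mod_cast hia'
          push_cast at this; linarith
        have key := hdl2 a a le_rfl (by linarith)
        have e3 : (1 - q) * (q * TAIL[μ₂, M₂, j]) ≤ (1 - q) * y := mul_le_mul_of_nonneg_left hcase (by linarith)
        have htot : q * y ≤ q * (q * TAIL[μ₂, M₂, j] + ∑ s ∈ Finset.range (M₂ + 1), (if s ≤ j ∧ (j : ℝ) < s + κ then μ₂ s else 0)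
            + y * ∑ s ∈ Finset.range (M₂ + 1), (if s ≤ a ∧ u < s then μ₂ s else 0)) := by
          rw [hd, mul_zero, add_zero, show ∑ s ∈ Finset.range (M₂ + 1), (if s ≤ j ∧ (j : ℝ) < s + κ then μ₂ s else 0)
                = TAIL[μ₂, M₂, a] - TAIL[μ₂, M₂, j] by rw [← hmid]; ring]
          nlinarith [hG0 i', hG0 a]
        exact le_of_mul_le_mul_left htot hq0

/-! ### Factor 1: the profile minorant -/

/-- **the profile minorant.**  `ν` a probability law on `{0..M}` with the two-layer giant bounds at target `t` (`y ≤ 1`); `s ≤ j`.  Then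
`(1−y)·ν{h : j+1 ≤ h+s} ≥ Σ_{2k < t} ν(k)·([j < s+k] + y·[s+k ≤ j, j+k < t+s]) + (ν{2k ≥ t} − y)·[j < s + t/2]` — an identity when the
layer `j − s` is dominant (`2(j−s) < t`), one bound of the family (at `(j−s, ⌈t−(j−s)⌉−1)`) otherwise. [this work] -/
theorem profile_minorant (y t : ℝ) (j s M : ℕ) (ν : ℕ → ℝ) (hy1 : y ≤ 1) (hν0 : ∀ h, 0 ≤ ν h)
    (hν1 : ∑ h ∈ Finset.range (M + 1), ν h = 1)
    (hdl : ∀ i i' : ℕ, i' ≤ i → (i : ℝ) + i' < t → y * LOW[ν, M, i'] ≤ (1 - y) * TAIL[ν, M, i]) (hsj : s ≤ j) :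
    ∑ k ∈ Finset.range (M + 1), (if 2 * (k : ℝ) < t then ν k else 0)
        * ((if (j : ℝ) < s + k then (1 : ℝ) else 0) + y * (if (s : ℝ) + k ≤ j ∧ (j : ℝ) + k < t + s then (1 : ℝ) else 0))
      + ((∑ k ∈ Finset.range (M + 1), (if 2 * (k : ℝ) < t then 0 else ν k)) - y) * (if (j : ℝ) < s + t / 2 then (1 : ℝ) else 0)
      ≤ (1 - y) * ∑ h ∈ Finset.range (M + 1), (if j + 1 ≤ h + s then ν h else 0) := by
  obtain ⟨i, rfl⟩ : ∃ i, j = i + s := ⟨j - s, by omega⟩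
  push_cast
  have htail : ∑ h ∈ Finset.range (M + 1), (if i + s + 1 ≤ h + s then ν h else 0) = TAIL[ν, M, i] :=
    Finset.sum_congr rfl fun h _ => by
      by_cases hh : i + 1 ≤ h
      · rw [if_pos (by omega), if_pos hh]
      · rw [if_neg (by omega), if_neg hh]
  rw [htail]
  have hT0 : 0 ≤ TAIL[ν, M, i] := Finset.sum_nonneg fun h _ => by split_ifs; exacts [hν0 h, le_rfl]
  have hLT : LOW[ν, M, i] + TAIL[ν, M, i] = 1 := by rw [sum_le_add_sum_gt, hν1]
  by_cases hdomi : 2 * (i : ℝ) < t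
  · -- dominant layer: an identity
    rw [if_pos (by linarith : (i : ℝ) + s < s + t / 2), mul_one]
    have hpt : ∀ k ∈ Finset.range (M + 1),
        (if 2 * (k : ℝ) < t then ν k else 0) * ((if (i : ℝ) + s < s + k then (1 : ℝ) else 0)
            + y * (if (s : ℝ) + k ≤ i + s ∧ (i : ℝ) + s + k < t + s then (1 : ℝ) else 0))
          + (if 2 * (k : ℝ) < t then 0 else ν k)
          = (if i + 1 ≤ k then ν k else 0) + y * (if k ≤ i then ν k else 0) := by
      intro k _
      by_cases hki : k ≤ i
      · have hk' : (k : ℝ) ≤ i := by exact_mod_cast hki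
        rw [if_pos (by linarith : 2 * (k : ℝ) < t), if_pos (by linarith : 2 * (k : ℝ) < t),
          if_neg (by linarith : ¬ ((i : ℝ) + s < s + k)),
          if_pos (⟨by linarith, by linarith⟩ : (s : ℝ) + k ≤ i + s ∧ (i : ℝ) + s + k < t + s),
          if_neg (by omega : ¬ (i + 1 ≤ k)), if_pos hki]
        ring
      · have hk' : (i : ℝ) < k := by exact_mod_cast (not_le.1 hki)
        rw [if_pos (by linarith : (i : ℝ) + s < s + k), if_pos (by omega : i + 1 ≤ k), if_neg hki,
          if_neg (show ¬ ((s : ℝ) + k ≤ i + s ∧ (i : ℝ) + s + k < t + s) from fun h => by rcases h with ⟨h1, _⟩; linarith)]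
        split_ifs <;> ring
    have hsum : ∑ k ∈ Finset.range (M + 1), (if 2 * (k : ℝ) < t then ν k else 0) * ((if (i : ℝ) + s < s + k then (1 : ℝ) else 0)
            + y * (if (s : ℝ) + k ≤ i + s ∧ (i : ℝ) + s + k < t + s then (1 : ℝ) else 0))
          + ∑ k ∈ Finset.range (M + 1), (if 2 * (k : ℝ) < t then 0 else ν k) = TAIL[ν, M, i] + y * LOW[ν, M, i] := by
      rw [← Finset.sum_add_distrib, Finset.sum_congr rfl hpt, Finset.sum_add_distrib, ← Finset.mul_sum]
    nlinarith
  · -- non-dominant layer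
    have hdomi' : t ≤ 2 * (i : ℝ) := not_lt.1 hdomi
    rw [if_neg (by linarith : ¬ ((i : ℝ) + s < s + t / 2)), mul_zero, add_zero]
    have hpt : ∀ k ∈ Finset.range (M + 1),
        (if 2 * (k : ℝ) < t then ν k else 0) * ((if (i : ℝ) + s < s + k then (1 : ℝ) else 0)
            + y * (if (s : ℝ) + k ≤ i + s ∧ (i : ℝ) + s + k < t + s then (1 : ℝ) else 0))
          = y * (if (i : ℝ) + k < t then ν k else 0) := by
      intro k _
      by_cases hik : (i : ℝ) + k < t
      · rw [if_pos (by linarith : 2 * (k : ℝ) < t), if_neg (by linarith : ¬ ((i : ℝ) + s < s + k)),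
          if_pos (⟨by linarith, by linarith⟩ : (s : ℝ) + k ≤ i + s ∧ (i : ℝ) + s + k < t + s), if_pos hik]
        ring
      · rw [if_neg hik, if_neg (show ¬ ((s : ℝ) + k ≤ i + s ∧ (i : ℝ) + s + k < t + s) from
          fun h => hik (by rcases h with ⟨_, h2⟩; linarith))]
        by_cases h2k : 2 * (k : ℝ) < t
        · rw [if_pos h2k, if_neg (by linarith : ¬ ((i : ℝ) + s < s + k))]; ring
        · rw [if_neg h2k]; ring
    rw [Finset.sum_congr rfl hpt, ← Finset.mul_sum]
    by_cases hti : t ≤ i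
    · have hz : ∑ k ∈ Finset.range (M + 1), (if (i : ℝ) + k < t then ν k else 0) = 0 :=
        Finset.sum_eq_zero fun k _ => if_neg (by linarith [(Nat.cast_nonneg k : (0 : ℝ) ≤ k)])
      rw [hz, mul_zero]
      exact mul_nonneg (by linarith) hT0
    · have hti' : (i : ℝ) < t := not_le.1 hti
      set n : ℕ := ⌈t - (i : ℝ)⌉₊ with hn
      have hn0 : 0 < n := Nat.ceil_pos.2 (by linarith)
      have hn1 : (((n - 1 : ℕ) : ℝ)) < t - i := by
        have : n - 1 < n := by omega
        rw [hn] at this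
        exact (Nat.lt_ceil).1 this
      have hni : n - 1 ≤ i := by
        have : (((n - 1 : ℕ) : ℝ)) < i := by linarith
        exact_mod_cast this.le
      have hz : ∑ k ∈ Finset.range (M + 1), (if (i : ℝ) + k < t then ν k else 0) = LOW[ν, M, n - 1] :=
        Finset.sum_congr rfl fun k _ => by
          have e : ((i : ℝ) + k < t) ↔ k ≤ n - 1 := by
            rw [show ((i : ℝ) + k < t) ↔ ((k : ℝ) < t - i) from ⟨fun h => by linarith, fun h => by linarith⟩, ← Nat.lt_ceil, ← hn]
            omega
          simp only [e]
      rw [hz]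
      exact hdl i (n - 1) hni (by linarith)

/-- **the mass at the non-dominant atoms is at least `y`**: `ν{k : 2k ≥ t} ≥ y` — the far row of `ν` at its last dominant layer
(`y ≤ 1`; all of `ν` if `t ≤ 0`). [this work] -/
theorem nondominant_mass_ge (y t : ℝ) (M : ℕ) (ν : ℕ → ℝ) (hy1 : y ≤ 1) (hν1 : ∑ h ∈ Finset.range (M + 1), ν h = 1)
    (hdl : ∀ i i' : ℕ, i' ≤ i → (i : ℝ) + i' < t → y * LOW[ν, M, i'] ≤ (1 - y) * TAIL[ν, M, i]) :
    y ≤ ∑ k ∈ Finset.range (M + 1), (if 2 * (k : ℝ) < t then 0 else ν k) := by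
  by_cases ht : t ≤ 0
  · rw [Finset.sum_congr rfl fun k _ => if_neg (by linarith [(Nat.cast_nonneg k : (0 : ℝ) ≤ k)]), hν1]
    exact hy1
  · have ht' : 0 < t := not_le.1 ht
    set m : ℕ := ⌈t / 2⌉₊ with hm
    have hm0 : 0 < m := Nat.ceil_pos.2 (by linarith)
    have hm1 : (((m - 1 : ℕ) : ℝ)) < t / 2 := by
      have : m - 1 < m := by omega
      rw [hm] at this
      exact (Nat.lt_ceil).1 this
    have hz : ∑ k ∈ Finset.range (M + 1), (if 2 * (k : ℝ) < t then 0 else ν k) = TAIL[ν, M, m - 1] :=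
      Finset.sum_congr rfl fun k _ => by
        have e : (2 * (k : ℝ) < t) ↔ ¬ (m - 1 + 1 ≤ k) := by
          rw [show (2 * (k : ℝ) < t) ↔ ((k : ℝ) < t / 2) from ⟨fun h => by linarith, fun h => by linarith⟩, ← Nat.lt_ceil, ← hm]
          omega
        simp only [e, ite_not]
    rw [hz]
    have h1 := hdl (m - 1) (m - 1) le_rfl (by linarith)
    have h2 : LOW[ν, M, m - 1] + TAIL[ν, M, m - 1] = 1 := by rw [sum_le_add_sum_gt, hν1]
    nlinarith

/-! ### The bookkeeping -/

/-- **assembly.**  If `Σ_k c_k·W_k(s) + R·W′(s) ≤ (1−y)·V(s)` for every `s`, every `Σ_s μ₂(s)·W_k(s) ≥ y`, `Σ_s μ₂(s)·W′(s) ≥ y`,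
`Σ_k c_k + R = 1 − y` with `c, R, μ₂ ≥ 0` and `y < 1`, then `y ≤ Σ_s μ₂(s)·V(s)`. [this work] -/
theorem assemble_dominant (y R : ℝ) (M₁ M₂ : ℕ) (μ₂ : ℕ → ℝ) (c W' V : ℕ → ℝ) (W : ℕ → ℕ → ℝ) (hy1 : y < 1)
    (h20 : ∀ h, 0 ≤ μ₂ h) (hc0 : ∀ k, 0 ≤ c k) (hR0 : 0 ≤ R)
    (hcR : ∑ k ∈ Finset.range (M₁ + 1), c k + R = 1 - y)
    (hpt : ∀ s ∈ Finset.range (M₂ + 1), ∑ k ∈ Finset.range (M₁ + 1), c k * W k s + R * W' s ≤ (1 - y) * V s)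
    (hWk : ∀ k ∈ Finset.range (M₁ + 1), y ≤ ∑ s ∈ Finset.range (M₂ + 1), μ₂ s * W k s)
    (hW' : y ≤ ∑ s ∈ Finset.range (M₂ + 1), μ₂ s * W' s) :
    y ≤ ∑ s ∈ Finset.range (M₂ + 1), μ₂ s * V s := by
  have h1y : 0 < 1 - y := by linarith
  -- `(1−y)·Σ μ₂ V ≥ Σ_s μ₂ s (Σ_k c_k W_k s + R W′ s)`
  have hup : ∑ s ∈ Finset.range (M₂ + 1), μ₂ s * (∑ k ∈ Finset.range (M₁ + 1), c k * W k s + R * W' s)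
      ≤ (1 - y) * ∑ s ∈ Finset.range (M₂ + 1), μ₂ s * V s := by
    rw [Finset.mul_sum]
    refine Finset.sum_le_sum fun s hs => ?_
    have := mul_le_mul_of_nonneg_left (hpt s hs) (h20 s)
    linarith [this]
  -- reorganise the left side
  have hre : ∑ s ∈ Finset.range (M₂ + 1), μ₂ s * (∑ k ∈ Finset.range (M₁ + 1), c k * W k s + R * W' s)
      = ∑ k ∈ Finset.range (M₁ + 1), c k * (∑ s ∈ Finset.range (M₂ + 1), μ₂ s * W k s)
        + R * ∑ s ∈ Finset.range (M₂ + 1), μ₂ s * W' s := by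
    have e1 : ∀ s ∈ Finset.range (M₂ + 1), μ₂ s * (∑ k ∈ Finset.range (M₁ + 1), c k * W k s + R * W' s)
        = (∑ k ∈ Finset.range (M₁ + 1), c k * (μ₂ s * W k s)) + R * (μ₂ s * W' s) := by
      intro s _
      rw [mul_add, Finset.mul_sum]
      congr 1
      · exact Finset.sum_congr rfl fun k _ => by ring
      · ring
    rw [Finset.sum_congr rfl e1, Finset.sum_add_distrib, Finset.sum_comm, ← Finset.mul_sum]
    congr 1
    exact Finset.sum_congr rfl fun k _ => by rw [Finset.mul_sum]
  have hlow : (1 - y) * y ≤ ∑ k ∈ Finset.range (M₁ + 1), c k * (∑ s ∈ Finset.range (M₂ + 1), μ₂ s * W k s)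
      + R * ∑ s ∈ Finset.range (M₂ + 1), μ₂ s * W' s := by
    calc (1 - y) * y = ∑ k ∈ Finset.range (M₁ + 1), c k * y + R * y := by rw [← Finset.sum_mul, ← add_mul, hcR]
      _ ≤ _ := add_le_add (Finset.sum_le_sum fun k hk => mul_le_mul_of_nonneg_left (hWk k hk) (hc0 k))
          (mul_le_mul_of_nonneg_left hW' hR0)
  have : (1 - y) * y ≤ (1 - y) * ∑ s ∈ Finset.range (M₂ + 1), μ₂ s * V s := by linarith [hup, hre, hlow]
  exact le_of_mul_le_mul_left this h1y

end LawDec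

end Quant

end Summit.CriticalPhenomena.PercolationContinuityZ3.Theorems
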